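import Summits.QuantumFields.QCD.Theorems.QuarksAsStableActionUnquenchedChessboardBoundStubAssemblyAux1
import Mathlib
import HarnessLib

/-!
# Assembly of the unquenched chessboard bound, part 2: cell words, translations, time reflection
(stub `stub_assembly` of crux stmt-QuantumFields-9735, line Sketch; auxiliary file 2)

Abstract bookkeeping for the chessboard estimate on the four-torus of cells `c : Fin 4 → ZMod L`:
letters are finite sets of cell-plaquette labels `q : κ`, placed at plaquettes `pos c q`; the word
event is `{U | every placed plaquette of every cell is δ-bad}` and the word functional is
`Φ(w) = Re ∫ 1_{event(w)} W dHaar` for a weight `W`.  We prove, for a placement `pos` that is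
translation covariant, reflection covariant (`sitePlaqReflect (pos c q) = pos (θ₀ c) (fl q)` for an
involution `fl`, `θ₀ c = c[0 ↦ -1 - c 0]`) and local in the closed half `{0 ≤ t ≤ L/2}`, and a
bounded measurable real `Θ'`-invariant weight that is reflection positive on half-observables:
translation invariance of `Φ`, and the two reflection hypotheses of the abstract chessboard estimate
in the time axis (non-negativity of symmetrised words, reflection Cauchy–Schwarz).
All statements here are proved; no definitions are introduced.
-/

noncomputable section

open MeasureTheory Matrix Complex Finset
open Literature.MathematicalPhysics.QuantumFieldTheory Literature.MathematicalPhysics.QuantumLattice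
open scoped ComplexConjugate BigOperators ComplexOrder

namespace Summit.QuantumFields.QCD.Theorems.UnquenchedChessboardBoundLine

section Words

variable {L N : ℕ} [NeZero L]
variable {G : Type*} [Group G] [TopologicalSpace G] [IsTopologicalGroup G] [CompactSpace G]
  [MeasurableSpace G] [BorelSpace G]
variable (ρ : G →* Matrix (Fin N) (Fin N) ℂ) (δ : ℝ)
variable {κ : Type*} [DecidableEq κ] (pos : (Fin 4 → ZMod L) → κ → Plaquette 4 L)

/-! ## Plaquette deficits: measurability and covariance -/

omit [NeZero L] [CompactSpace G] in
/-- The plaquette deficit is a measurable function of the field. -/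
theorem asm_measurable_plaquetteDeficit (hρ : Continuous ρ) (p : Plaquette 4 L) :
    Measurable fun U : GaugeConfig 4 L G => plaquetteDeficit ρ U p :=
  measurable_const.sub (WilsonRP.measurable_plaqRe ρ hρ p)

omit [NeZero L] [TopologicalSpace G] [IsTopologicalGroup G] [CompactSpace G] [BorelSpace G] in
/-- Deficits of a translated field are translated deficits. -/
theorem asm_plaquetteDeficit_torusConfigShift (v : Site 4 L) (U : GaugeConfig 4 L G) (p : Plaquette 4 L) :
    plaquetteDeficit ρ (torusConfigShift v U) p = plaquetteDeficit ρ U (p.1 - v, p.2) := by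
  simp only [plaquetteDeficit, plaquetteHolonomy_torusConfigShift]

omit [NeZero L] [MeasurableSpace G] [BorelSpace G] in
/-- Deficits of the reflected field are deficits at the reflected plaquettes. -/
theorem asm_plaquetteDeficit_negReflect (hρ : Continuous ρ) (U : GaugeConfig 4 L G) (p : Plaquette 4 L) :
    plaquetteDeficit ρ (GaugeConfig.negReflect U) p =
      plaquetteDeficit ρ U (WilsonSiteRP.sitePlaqReflect p) := by
  change (N : ℝ) - WilsonRP.plaqRe ρ _ p = (N : ℝ) - WilsonRP.plaqRe ρ U _
  rw [WilsonSiteRP.plaqRe_negReflect ρ hρ]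

omit [CompactSpace G] [DecidableEq κ] in
/-- Word events restricted to a set of cells are measurable. -/
theorem asm_measurableSet_wordEvent (hρ : Continuous ρ) (P : (Fin 4 → ZMod L) → Prop)
    (w : (Fin 4 → ZMod L) → Finset κ) :
    MeasurableSet {U : GaugeConfig 4 L G | ∀ c, P c → ∀ q ∈ w c, δ ≤ plaquetteDeficit ρ U (pos c q)} := by
  classical
  have h : {U : GaugeConfig 4 L G | ∀ c, P c → ∀ q ∈ w c, δ ≤ plaquetteDeficit ρ U (pos c q)} =
      ⋂ c ∈ (Finset.univ.filter P), ⋂ q ∈ w c,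
        {U : GaugeConfig 4 L G | δ ≤ plaquetteDeficit ρ U (pos c q)} := by
    ext U
    simp
  rw [h]
  exact Finset.measurableSet_biInter _ fun c _ => Finset.measurableSet_biInter _ fun q _ =>
    measurableSet_le measurable_const (asm_measurable_plaquetteDeficit ρ hρ _)

omit [CompactSpace G] [DecidableEq κ] in
/-- Full word events are measurable. -/
theorem asm_measurableSet_wordEvent' (hρ : Continuous ρ) (w : (Fin 4 → ZMod L) → Finset κ) :
    MeasurableSet {U : GaugeConfig 4 L G | ∀ c, ∀ q ∈ w c, δ ≤ plaquetteDeficit ρ U (pos c q)} := by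
  have h : {U : GaugeConfig 4 L G | ∀ c, ∀ q ∈ w c, δ ≤ plaquetteDeficit ρ U (pos c q)} =
      {U : GaugeConfig 4 L G | ∀ c, True → ∀ q ∈ w c, δ ≤ plaquetteDeficit ρ U (pos c q)} := by
    ext U; simp
  rw [h]
  exact asm_measurableSet_wordEvent ρ δ pos hρ _ w

/-! ## Translation invariance of the word functional -/

omit [NeZero L] [TopologicalSpace G] [IsTopologicalGroup G] [CompactSpace G] [BorelSpace G]
  [DecidableEq κ] in
/-- The event of a translated word is the translate of the event. -/
theorem asm_wordEvent_shift (hps : ∀ c v q, pos (c + v) q = ((pos c q).1 + v, (pos c q).2))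
    (w : (Fin 4 → ZMod L) → Finset κ) (v : Fin 4 → ZMod L) :
    {U : GaugeConfig 4 L G | ∀ c, ∀ q ∈ w (c + v), δ ≤ plaquetteDeficit ρ U (pos c q)} =
      (torusConfigShift v) ⁻¹'
        {U : GaugeConfig 4 L G | ∀ c, ∀ q ∈ w c, δ ≤ plaquetteDeficit ρ U (pos c q)} := by
  ext U
  simp only [Set.mem_setOf_eq, Set.mem_preimage, asm_plaquetteDeficit_torusConfigShift]
  constructor
  · intro h c q hq
    have h' := h (c - v) q (by rwa [sub_add_cancel])
    have hc : pos c q = pos (c - v + v) q := by rw [sub_add_cancel]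
    rw [hc, hps]
    simpa using h'
  · intro h c q hq
    have h' := h (c + v) q hq
    rw [hps] at h'
    simpa using h'

omit [DecidableEq κ] in
/-- **Translation invariance** of `Φ(w) = Re ∫ 1_{event(w)} W dHaar` for a translation-covariant
placement and a translation-invariant weight. -/
theorem asm_phi_shift (hps : ∀ c v q, pos (c + v) q = ((pos c q).1 + v, (pos c q).2))
    (W : GaugeConfig 4 L G → ℂ) (hW : ∀ v U, W (torusConfigShift v U) = W U)
    (w : (Fin 4 → ZMod L) → Finset κ) (v : Fin 4 → ZMod L) :
    (∫ U, {U : GaugeConfig 4 L G | ∀ c, ∀ q ∈ w (c + v), δ ≤ plaquetteDeficit ρ U (pos c q)}.indicator 1 U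
        * W U ∂(Measure.pi fun _ : Edge 4 L => haarProbability G)).re =
      (∫ U, {U : GaugeConfig 4 L G | ∀ c, ∀ q ∈ w c, δ ≤ plaquetteDeficit ρ U (pos c q)}.indicator 1 U
        * W U ∂(Measure.pi fun _ : Edge 4 L => haarProbability G)).re := by
  rw [asm_wordEvent_shift ρ δ pos hps w v]
  rw [← asm_integral_comp_torusConfigShift_pi (haarProbability G) v (fun U =>
    {U : GaugeConfig 4 L G | ∀ c, ∀ q ∈ w c, δ ≤ plaquetteDeficit ρ U (pos c q)}.indicator 1 U * W U)]
  congr 2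
  funext U
  rw [hW]
  congr 1

/-! ## The time reflection of cells -/

omit [NeZero L] in
/-- The cell reflection `θ₀ c = c[0 ↦ -1 - c 0]` is an involution. -/
theorem asm_cellReflect_cellReflect (c : Fin 4 → ZMod L) :
    Function.update (Function.update c 0 (-1 - c 0)) 0
        (-1 - Function.update c 0 (-1 - c 0) 0) = c := by
  simp [Function.update_idem]

/-- The time coordinate of the reflected cell. -/
theorem asm_val_cellReflect (c : Fin 4 → ZMod L) :
    (Function.update c 0 (-1 - c 0) 0).val = L - 1 - (c 0).val := by
  rw [Function.update_self]
  have hlt := ZMod.val_lt (c 0)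
  have h1 : (-1 - c 0 : ZMod L) = ((L - 1 - (c 0).val : ℕ) : ZMod L) := by
    have h2 : ((L - 1 - (c 0).val : ℕ) : ZMod L) + (c 0).val + 1 = 0 := by
      have : ((L - 1 - (c 0).val : ℕ) : ZMod L) + ((c 0).val : ZMod L) + 1 =
          ((L - 1 - (c 0).val + (c 0).val + 1 : ℕ) : ZMod L) := by push_cast; ring
      rw [this, show L - 1 - (c 0).val + (c 0).val + 1 = L by omega, ZMod.natCast_self]
    rw [ZMod.natCast_zmod_val] at h2
    linear_combination -h2
  rw [h1, ZMod.val_natCast, Nat.mod_eq_of_lt (by omega)]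

/-- For even `L` the reflection exchanges the two halves `{t < L/2}` and `{t ≥ L/2}`. -/
theorem asm_half_cellReflect_iff (hL : Even L) (c : Fin 4 → ZMod L) :
    (Function.update c 0 (-1 - c 0) 0).val < L / 2 ↔ ¬ (c 0).val < L / 2 := by
  rw [asm_val_cellReflect]
  have hlt := ZMod.val_lt (c 0)
  obtain ⟨r, hr⟩ := hL
  omega

/-! ## Reflection of cell events -/

omit [NeZero L] [MeasurableSpace G] [BorelSpace G] in
/-- A letter is bad at cell `c` for the reflected field iff its flipped letter is bad at the
reflected cell for the field. -/
theorem asm_cellBad_negReflect (hρ : Continuous ρ) {fl : κ → κ}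
    (hpr : ∀ c q, WilsonSiteRP.sitePlaqReflect (pos c q) = pos (Function.update c 0 (-1 - c 0)) (fl q))
    (U : GaugeConfig 4 L G) (c : Fin 4 → ZMod L) (a : Finset κ) :
    (∀ q ∈ a, δ ≤ plaquetteDeficit ρ (GaugeConfig.negReflect U) (pos c q)) ↔
      ∀ q ∈ a.image fl, δ ≤ plaquetteDeficit ρ U (pos (Function.update c 0 (-1 - c 0)) q) := by
  rw [Finset.forall_mem_image]
  refine forall₂_congr fun q _ => ?_
  rw [asm_plaquetteDeficit_negReflect ρ hρ, hpr]

omit [NeZero L] [DecidableEq κ] [TopologicalSpace G] [IsTopologicalGroup G] [CompactSpace G]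
  [MeasurableSpace G] [BorelSpace G] in
/-- Half events only depend on the letters of the half. -/
theorem asm_halfEvent_congr {w w' : (Fin 4 → ZMod L) → Finset κ}
    (h : ∀ c, (c 0).val < L / 2 → w c = w' c) :
    {U : GaugeConfig 4 L G | ∀ c, (c 0).val < L / 2 → ∀ q ∈ w c, δ ≤ plaquetteDeficit ρ U (pos c q)} =
      {U : GaugeConfig 4 L G | ∀ c, (c 0).val < L / 2 → ∀ q ∈ w' c, δ ≤ plaquetteDeficit ρ U (pos c q)} := by
  ext U
  simp only [Set.mem_setOf_eq]
  refine forall_congr' fun c => forall_congr' fun hc => ?_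
  rw [h c hc]

omit [MeasurableSpace G] [BorelSpace G] in
/-- **Splitting of a word event** into its positive half and the reflection of the flipped
negative half. -/
theorem asm_wordEvent_split (hL : Even L) (hρ : Continuous ρ) {fl : κ → κ} (hfl : Function.Involutive fl)
    (hpr : ∀ c q, WilsonSiteRP.sitePlaqReflect (pos c q) = pos (Function.update c 0 (-1 - c 0)) (fl q))
    (w : (Fin 4 → ZMod L) → Finset κ) :
    {U : GaugeConfig 4 L G | ∀ c, ∀ q ∈ w c, δ ≤ plaquetteDeficit ρ U (pos c q)} =
      {U : GaugeConfig 4 L G | ∀ c, (c 0).val < L / 2 → ∀ q ∈ w c, δ ≤ plaquetteDeficit ρ U (pos c q)} ∩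
      GaugeConfig.negReflect ⁻¹'
        {U : GaugeConfig 4 L G | ∀ c, (c 0).val < L / 2 →
          ∀ q ∈ (w (Function.update c 0 (-1 - c 0))).image fl, δ ≤ plaquetteDeficit ρ U (pos c q)} := by
  ext U
  simp only [Set.mem_setOf_eq, Set.mem_inter_iff, Set.mem_preimage]
  constructor
  · intro h
    refine ⟨fun c _ => h c, fun c _ => ?_⟩
    rw [asm_cellBad_negReflect ρ δ pos hρ hpr, Finset.image_image, hfl.comp_self, Finset.image_id]
    exact h _
  · rintro ⟨h1, h2⟩ c
    by_cases hc : (c 0).val < L / 2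
    · exact h1 c hc
    · have hc' := (asm_half_cellReflect_iff hL c).2 hc
      have h3 := h2 _ hc'
      rw [asm_cellReflect_cellReflect, asm_cellBad_negReflect ρ δ pos hρ hpr, Finset.image_image,
        hfl.comp_self, Finset.image_id, asm_cellReflect_cellReflect] at h3
      exact h3

/-! ## Half-observables and locality -/

omit [MeasurableSpace G] [BorelSpace G] [TopologicalSpace G] [IsTopologicalGroup G] [CompactSpace G] in
/-- Deficits of positive or shared plaquettes only depend on the links of the closed half. -/
theorem asm_plaquetteDeficit_congr_of_half [Fact (1 < L)] (hL : Even L) {p : Plaquette 4 L}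
    (hp : WilsonSiteRP.IsSitePosPlaq p ∨ WilsonSiteRP.IsSharedPlaq p) {U V : GaugeConfig 4 L G}
    (hUV : ∀ e ∈ ((WilsonSiteRP.sitePosEdges ∪ WilsonSiteRP.sharedEdges : Finset (Edge 4 L)) :
      Set (Edge 4 L)), U e = V e) :
    plaquetteDeficit ρ U p = plaquetteDeficit ρ V p := by
  have h : ∀ e, WilsonSiteRP.IsSitePosEdge e ∨ WilsonSiteRP.IsSharedEdge e → U e = V e :=
    fun e he => hUV e (by rcases he with he | he <;> simp [he])
  have h4 : (WilsonSiteRP.IsSitePosEdge (p.1, p.2.1.1) ∨ WilsonSiteRP.IsSharedEdge (p.1, p.2.1.1)) ∧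
      (WilsonSiteRP.IsSitePosEdge (p.1.shift p.2.1.1, p.2.1.2) ∨
        WilsonSiteRP.IsSharedEdge (p.1.shift p.2.1.1, p.2.1.2)) ∧
      (WilsonSiteRP.IsSitePosEdge (p.1.shift p.2.1.2, p.2.1.1) ∨
        WilsonSiteRP.IsSharedEdge (p.1.shift p.2.1.2, p.2.1.1)) ∧
      (WilsonSiteRP.IsSitePosEdge (p.1, p.2.1.2) ∨ WilsonSiteRP.IsSharedEdge (p.1, p.2.1.2)) := by
    rcases hp with hp | hp
    · exact WilsonSiteRP.edges_of_isSitePosPlaq hL hp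
    · obtain ⟨h1, h2, h3, h4⟩ := WilsonSiteRP.edges_of_isSharedPlaq hp
      exact ⟨Or.inr h1, Or.inr h2, Or.inr h3, Or.inr h4⟩
  obtain ⟨h1, h2, h3, h4⟩ := h4
  simp only [plaquetteDeficit, plaquetteHolonomy, h _ h1, h _ h2, h _ h3, h _ h4]

omit [CompactSpace G] [DecidableEq κ] in
/-- **The indicator of a half event is an admissible half-observable** (bounded, measurable,
depending only on the links of the closed half `{0 ≤ t ≤ L/2}`), provided every plaquette placed
in a cell of the half `{t < L/2}` is positive or shared. -/
theorem asm_isHalfObs_halfIndicator [Fact (1 < L)] (hL : Even L) (hρ : Continuous ρ)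
    (hloc : ∀ c q, (c 0).val < L / 2 →
      WilsonSiteRP.IsSitePosPlaq (pos c q) ∨ WilsonSiteRP.IsSharedPlaq (pos c q))
    (w : (Fin 4 → ZMod L) → Finset κ) :
    WilsonSiteRP.IsHalfObs
      ({U : GaugeConfig 4 L G | ∀ c, (c 0).val < L / 2 → ∀ q ∈ w c,
        δ ≤ plaquetteDeficit ρ U (pos c q)}.indicator (1 : GaugeConfig 4 L G → ℂ)) := by
  refine ⟨measurable_one.indicator (asm_measurableSet_wordEvent ρ δ pos hρ _ w), ⟨1, fun U => ?_⟩, ?_⟩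
  · rw [Set.indicator_apply]
    split_ifs <;> simp
  · intro U V hUV
    have hmem : U ∈ {U : GaugeConfig 4 L G | ∀ c, (c 0).val < L / 2 → ∀ q ∈ w c,
        δ ≤ plaquetteDeficit ρ U (pos c q)} ↔ V ∈ {U : GaugeConfig 4 L G | ∀ c, (c 0).val < L / 2 →
        ∀ q ∈ w c, δ ≤ plaquetteDeficit ρ U (pos c q)} := by
      simp only [Set.mem_setOf_eq]
      refine forall_congr' fun c => forall_congr' fun hc => forall₂_congr fun q _ => ?_
      rw [asm_plaquetteDeficit_congr_of_half ρ hL (hloc c q hc) hUV]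
    simp only [Set.indicator_apply, hmem, Pi.one_apply]

omit [NeZero L] in
/-- Indicator algebra: `1_{s ∩ f⁻¹ t}(x) = conj 1_t(f x) · 1_s(x)`. -/
theorem asm_indicator_inter_preimage_one {X : Type*} (s t : Set X) (f : X → X) (x : X) :
    (s ∩ f ⁻¹' t).indicator (1 : X → ℂ) x = conj (t.indicator (1 : X → ℂ) (f x)) * s.indicator 1 x := by
  by_cases hs : x ∈ s <;> by_cases ht : f x ∈ t <;> simp [hs, ht]

/-! ## The two reflection hypotheses of the chessboard estimate in the time axis -/

omit [DecidableEq κ] in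
/-- The flipped-reflected word of a word symmetrised from its positive half is the word itself
on the positive half. -/
theorem asm_symmWord_hat (hL : Even L) {fl : κ → κ} [DecidableEq κ] (hfl : Function.Involutive fl)
    (w : (Fin 4 → ZMod L) → Finset κ) (c : Fin 4 → ZMod L) (hc : (c 0).val < L / 2) :
    ((fun c => if (c 0).val < L / 2 then w c
        else (w (Function.update c 0 (-1 - c 0))).image fl) (Function.update c 0 (-1 - c 0))).image fl =
      w c := by
  have hc' : ¬ (Function.update c 0 (-1 - c 0) 0).val < L / 2 := by
    rw [asm_half_cellReflect_iff hL]; exact not_not.2 hc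
  simp only [hc', if_false, asm_cellReflect_cellReflect, Finset.image_image, hfl.comp_self, Finset.image_id]

end Words

section MainAxis0

/-- **Reflection hypotheses in the time axis.** For a reflection-covariant local placement and a
bounded measurable real `Θ'`-invariant weight that is reflection positive on half-observables:
the symmetrised word `w|_H ∪ θ(w|_H)` has `Φ ≥ 0`, and
`Φ(w)² ≤ Φ(w|_H ∪ θ(w|_H)) · Φ(θ(w|_{Hᶜ}) ∪ w|_{Hᶜ})`. -/
theorem chess_axis0 {L N : ℕ} [NeZero L] {G : Type*} [Group G] [TopologicalSpace G]
    [IsTopologicalGroup G] [CompactSpace G] [MeasurableSpace G] [BorelSpace G]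
    (ρ : G →* Matrix (Fin N) (Fin N) ℂ) (δ : ℝ) {κ : Type*} [DecidableEq κ]
    (pos : (Fin 4 → ZMod L) → κ → Plaquette 4 L)
    [Fact (1 < L)] (hL : Even L) (hρ : Continuous ρ) {fl : κ → κ}
    (hfl : Function.Involutive fl)
    (hpr : ∀ c q, WilsonSiteRP.sitePlaqReflect (pos c q) = pos (Function.update c 0 (-1 - c 0)) (fl q))
    (hloc : ∀ c q, (c 0).val < L / 2 →
      WilsonSiteRP.IsSitePosPlaq (pos c q) ∨ WilsonSiteRP.IsSharedPlaq (pos c q))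
    (W : GaugeConfig 4 L G → ℂ) (hWm : Measurable W) (hWb : ∃ C, ∀ U, ‖W U‖ ≤ C)
    (hWr : ∀ U, conj (W U) = W U) (hWΘ : ∀ U, W (GaugeConfig.negReflect U) = W U)
    (hpos : ∀ F : GaugeConfig 4 L G → ℂ, WilsonSiteRP.IsHalfObs F →
      0 ≤ ∫ U, conj (F (GaugeConfig.negReflect U)) * F U * W U
        ∂(Measure.pi fun _ : Edge 4 L => haarProbability G))
    (w : (Fin 4 → ZMod L) → Finset κ) :
    0 ≤ (∫ U, {U : GaugeConfig 4 L G | ∀ c, ∀ q ∈ (fun c => if (c 0).val < L / 2 then w c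
          else (w (Function.update c 0 (-1 - c 0))).image fl) c, δ ≤ plaquetteDeficit ρ U (pos c q)}.indicator
          1 U * W U ∂(Measure.pi fun _ : Edge 4 L => haarProbability G)).re ∧
    (∫ U, {U : GaugeConfig 4 L G | ∀ c, ∀ q ∈ w c, δ ≤ plaquetteDeficit ρ U (pos c q)}.indicator 1 U
        * W U ∂(Measure.pi fun _ : Edge 4 L => haarProbability G)).re ^ 2 ≤
      (∫ U, {U : GaugeConfig 4 L G | ∀ c, ∀ q ∈ (fun c => if (c 0).val < L / 2 then w c
          else (w (Function.update c 0 (-1 - c 0))).image fl) c, δ ≤ plaquetteDeficit ρ U (pos c q)}.indicator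
          1 U * W U ∂(Measure.pi fun _ : Edge 4 L => haarProbability G)).re *
      (∫ U, {U : GaugeConfig 4 L G | ∀ c, ∀ q ∈ (fun c => if (c 0).val < L / 2
          then (w (Function.update c 0 (-1 - c 0))).image fl else w c) c,
          δ ≤ plaquetteDeficit ρ U (pos c q)}.indicator 1 U
        * W U ∂(Measure.pi fun _ : Edge 4 L => haarProbability G)).re := by
  set μ : Measure (GaugeConfig 4 L G) := Measure.pi fun _ : Edge 4 L => haarProbability G with hμ
  -- the two half events
  set Sp : Set (GaugeConfig 4 L G) := {U | ∀ c, (c 0).val < L / 2 → ∀ q ∈ w c,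
    δ ≤ plaquetteDeficit ρ U (pos c q)} with hSp
  set Sm : Set (GaugeConfig 4 L G) := {U | ∀ c, (c 0).val < L / 2 →
    ∀ q ∈ (w (Function.update c 0 (-1 - c 0))).image fl, δ ≤ plaquetteDeficit ρ U (pos c q)} with hSm
  have hFp : WilsonSiteRP.IsHalfObs (Sp.indicator (1 : GaugeConfig 4 L G → ℂ)) :=
    asm_isHalfObs_halfIndicator ρ δ pos hL hρ hloc w
  have hFm : WilsonSiteRP.IsHalfObs (Sm.indicator (1 : GaugeConfig 4 L G → ℂ)) :=
    asm_isHalfObs_halfIndicator ρ δ pos hL hρ hloc _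
  -- the three events
  have E1 : {U : GaugeConfig 4 L G | ∀ c, ∀ q ∈ w c, δ ≤ plaquetteDeficit ρ U (pos c q)} =
      Sp ∩ GaugeConfig.negReflect ⁻¹' Sm := asm_wordEvent_split ρ δ pos hL hρ hfl hpr w
  have E2 : {U : GaugeConfig 4 L G | ∀ c, ∀ q ∈ (fun c => if (c 0).val < L / 2 then w c
        else (w (Function.update c 0 (-1 - c 0))).image fl) c, δ ≤ plaquetteDeficit ρ U (pos c q)} =
      Sp ∩ GaugeConfig.negReflect ⁻¹' Sp := by
    rw [asm_wordEvent_split ρ δ pos hL hρ hfl hpr]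
    congr 1
    · exact asm_halfEvent_congr ρ δ pos fun c hc => if_pos hc
    · congr 1
      exact asm_halfEvent_congr ρ δ pos fun c hc => asm_symmWord_hat hL hfl w c hc
  have E3 : {U : GaugeConfig 4 L G | ∀ c, ∀ q ∈ (fun c => if (c 0).val < L / 2
        then (w (Function.update c 0 (-1 - c 0))).image fl else w c) c,
        δ ≤ plaquetteDeficit ρ U (pos c q)} = Sm ∩ GaugeConfig.negReflect ⁻¹' Sm := by
    rw [asm_wordEvent_split ρ δ pos hL hρ hfl hpr]
    congr 1
    · exact asm_halfEvent_congr ρ δ pos fun c hc => if_pos hc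
    · congr 1
      refine asm_halfEvent_congr ρ δ pos fun c hc => ?_
      have hc' : ¬ (Function.update c 0 (-1 - c 0) 0).val < L / 2 := by
        rw [asm_half_cellReflect_iff hL]; exact not_not.2 hc
      simp only [hc', if_false]
  -- the three integrals as values of the form
  have I : ∀ S T : Set (GaugeConfig 4 L G),
      ∫ U, (S ∩ GaugeConfig.negReflect ⁻¹' T).indicator (1 : GaugeConfig 4 L G → ℂ) U * W U ∂μ =
        ∫ U, conj (T.indicator (1 : GaugeConfig 4 L G → ℂ) (GaugeConfig.negReflect U)) *
          S.indicator 1 U * W U ∂μ := fun S T => by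
    simp_rw [asm_indicator_inter_preimage_one]
  rw [E1, E2, E3, I, I, I]
  refine ⟨(Complex.nonneg_iff.1 (hpos _ hFp)).1, ?_⟩
  rw [mul_comm]
  exact re_rpForm_sq_le hWm hWb hWr hWΘ hpos hFm hFp

end MainAxis0

end Summit.QuantumFields.QCD.Theorems.UnquenchedChessboardBoundLine

end
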